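import Mathlib
import Summits.NavierStokesRegularity.FluidComputer.AbcClassIISections

/-!
# Class-II layer of the skew-cut X0 chain, Part A2′ (prep): ARBITRARY orbit bases — change-of-basis
# coefficients, expansion of the basis families and of the first-order matrix
(instab4 g7 — implementation 2 of the skew-cut X0 certifier, cell `ns-blowup`, 2026-08-27)

HONEST FRAMING (human ruling D-0035): nothing here is a claim about Navier–Stokes blow-up.
WHAT THIS IS NOT: not NS evidence. MODEL lane (Navier–Stokes linearised about the forced ABC flow
`U = abcFlow 1 1 1`, `f = νU`); no certificate, number or census word moves.

The end-to-end theorem `AbcClassIISections.isLinNSEigenvalue_of_certificate` (instab4 g6) states its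
three finite-dimensional hypotheses (head determinant signs, shell numbers, tail constants) about the
real Galerkin matrices `[(x + |O|²/R)δ − amat]` in the EXISTENTIAL orbit-adapted basis `bfam`
(`orbitBasis O := stdOrthonormalBasis ℝ (realSpace O)`), which no program can compute in. The
certifiers (cert.py, i3cert) compute in THEIR OWN real orthonormal bases of the same class-II orbit
spaces. This file and its sequel (`AbcClassIIBases`) prove that the hypotheses are INVARIANT under the
change to an arbitrary family `e O` of real orthonormal bases of the orbit spaces `realSpace O`
(indexed, like `orbitBasis O`, by `Fin (odim O)`), so that the end-to-end theorem holds VERBATIM with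
`amat` replaced by the first-order matrix in the bases `e`.

This file: for a family `e` and its basis families `bf i = extend O_i (e O_i i.2)`:
* `ebfam_spec`, `ebfam_apply_of_not_mem`: supported on one orbit, transversal, class II, conj-symmetric;
* `coef_eq`: the pairings `Σ_{k ∈ O} ⟪bfam ⟨O,a⟩ k, bf ⟨O,b⟩ k⟫` are the (real) entries of the orthogonal
  change-of-basis matrix `M_O = (orbitBasis O).toBasis.toMatrix (e O)`; `ebfam_expand`: `bf ⟨O,b⟩ =
  Σ_a M_O a b • bfam ⟨O,a⟩`; `coefM_orth_cols` / `coefM_orth_rows`: `M_Oᵀ M_O = 1 = M_O M_Oᵀ` entrywise;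
* `eamat_eq`: the first-order matrix in the bases `e` is `Σ_{a a'} M a i · M a' j · amat a a'` orbitwise;
* `coefQ_*`: the same coefficients as a kernel `Q i j` on `Idx × Idx` (zero across orbits), and
  `sum_saturated`: sums over an orbit-saturated index set of a function living on one orbit.
Mathlib + `AbcClassIISections` (transitively the class-II layer); no new definitions.
-/

noncomputable section

open scoped BigOperators ComplexConjugate InnerProductSpace Matrix
open Finset Matrix

namespace Summit.NavierStokesRegularity.FluidComputer.AbcClassII

open Literature.Analysis.FunctionSpaces Literature.Analysis.FunctionSpaces.Torus
open Literature.Analysis.FunctionSpaces.EuclideanSpace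
open Literature.Analysis.FluidPDE Literature.Analysis.FluidPDE.SteadyLattice

/-! ## Part A2′ (prep). Arbitrary orbit bases (instab4 g7) -/

section BasesPrep

variable (e : ∀ O : Orbit, OrthonormalBasis (Fin (odim O)) ℝ (realSpace O.1))
variable (bf : Idx → Fam)
variable (hbf : ∀ i : Idx, bf i = extend i.1.1 ((e i.1 i.2 : realSpace i.1.1) : EuclideanSpace ℂ (↥i.1.1 × Fin 3)))

/-! ### §1 The basis families of an arbitrary family of orbit bases -/

section
include hbf

/-- The basis family of index `i` in the bases `e` is transversal, class II and conjugate-symmetric. -/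
theorem ebfam_spec (i : Idx) :
    (∀ k : Fin 3 → ℤ, ∑ j : Fin 3, ((k j : ℤ) : ℂ) * bf i k j = 0) ∧ IsClassII (bf i) ∧
      Torus.IsConjSymm (bf i) := by
  rw [hbf i]; exact (e i.1 i.2).2

/-- The basis family of index `i` in the bases `e` vanishes off the orbit of `i`. -/
theorem ebfam_apply_of_not_mem (i : Idx) {k : Fin 3 → ℤ} (hk : k ∉ i.1.1) : bf i k = 0 := by
  rw [hbf i]; exact extend_apply_of_not_mem _ hk

/-- Restricting the basis family of index `i` to its orbit gives back the basis vector. -/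
theorem restrictTo_ebfam (i : Idx) :
    restrictTo i.1.1 (bf i) = ((e i.1 i.2 : realSpace i.1.1) : EuclideanSpace ℂ (↥i.1.1 × Fin 3)) := by
  rw [hbf i, restrictTo_extend]

/-- **The change-of-basis coefficients**: `Σ_{k ∈ O} ⟪bfam ⟨O,a⟩ k, bf ⟨O,b⟩ k⟫ = M_O a b` with
`M_O = (orbitBasis O).toBasis.toMatrix (e O)` the (real, orthogonal) change-of-basis matrix. -/
theorem coef_eq (O : Orbit) (a b : Fin (odim O)) :
    ∑ k ∈ O.1, (inner ℂ (bfam ⟨O, a⟩ k) (bf ⟨O, b⟩ k) : ℂ) =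
      ((((orbitBasis O).toBasis.toMatrix (e O)) a b : ℝ) : ℂ) := by
  rw [sum_inner_bfam_eq_inner_restrictTo O a (bf ⟨O, b⟩), restrictTo_ebfam e bf hbf ⟨O, b⟩,
    inner_coe_realSpace (neg_mem_of_orbitClosed O.orbitClosed) (orbitBasis O a) (e O b),
    Module.Basis.toMatrix_apply, OrthonormalBasis.coe_toBasis_repr_apply, OrthonormalBasis.repr_apply_apply]

/-- **Expansion of the new basis families in the old ones**: `bf ⟨O,b⟩ = Σ_a M_O a b • bfam ⟨O,a⟩`. -/
theorem ebfam_expand (O : Orbit) (b : Fin (odim O)) :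
    bf ⟨O, b⟩ = ∑ a : Fin (odim O), ((((orbitBasis O).toBasis.toMatrix (e O)) a b : ℝ) : ℂ) • bfam ⟨O, a⟩ := by
  have hs := ebfam_spec e bf hbf ⟨O, b⟩
  have h := expand_complex O (c := bf ⟨O, b⟩) (fun k hk => ebfam_apply_of_not_mem e bf hbf ⟨O, b⟩ hk) hs.1 hs.2.1
  conv_lhs => rw [h]
  exact Finset.sum_congr rfl fun a _ => by rw [coef_eq e bf hbf O a b]

end

/-- **Orthogonality of the change-of-basis matrix, columns**: `Σ_a M a b · M a b' = δ_{b b'}`. -/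
theorem coefM_orth_cols (O : Orbit) (b b' : Fin (odim O)) :
    ∑ a : Fin (odim O), ((orbitBasis O).toBasis.toMatrix (e O)) a b * ((orbitBasis O).toBasis.toMatrix (e O)) a b' =
      if b = b' then 1 else 0 := by
  have hQ := (orbitBasis O).toMatrix_orthonormalBasis_mem_orthogonal (e O)
  have h : ((orbitBasis O).toBasis.toMatrix (e O))ᵀ * (orbitBasis O).toBasis.toMatrix (e O) = 1 := by
    have h := Matrix.mem_unitaryGroup_iff'.mp hQ
    simpa only [star_eq_conjTranspose, conjTranspose_eq_transpose_of_trivial] using h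
  have h' := congrFun (congrFun h b) b'
  rw [Matrix.mul_apply, Matrix.one_apply] at h'
  simpa only [Matrix.transpose_apply] using h'

/-- **Orthogonality of the change-of-basis matrix, rows**: `Σ_b M a b · M a' b = δ_{a a'}`. -/
theorem coefM_orth_rows (O : Orbit) (a a' : Fin (odim O)) :
    ∑ b : Fin (odim O), ((orbitBasis O).toBasis.toMatrix (e O)) a b * ((orbitBasis O).toBasis.toMatrix (e O)) a' b =
      if a = a' then 1 else 0 := by
  have hQ := (orbitBasis O).toMatrix_orthonormalBasis_mem_orthogonal (e O)
  have h : (orbitBasis O).toBasis.toMatrix (e O) * ((orbitBasis O).toBasis.toMatrix (e O))ᵀ = 1 := by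
    have h := Matrix.mem_unitaryGroup_iff.mp hQ
    simpa only [star_eq_conjTranspose, conjTranspose_eq_transpose_of_trivial] using h
  have h' := congrFun (congrFun h a) a'
  rw [Matrix.mul_apply, Matrix.one_apply] at h'
  simpa only [Matrix.transpose_apply] using h'

section
include hbf

/-- **The first-order matrix in the bases `e`, expanded in the old one**:
`Re Σ_{k ∈ O_i} ⟪bf i k, Π_k X(bf j)(k)⟫ = Σ_{a, a'} M_{O_i} a i.2 · M_{O_j} a' j.2 · amat ⟨O_i,a⟩ ⟨O_j,a'⟩`. -/
theorem eamat_eq (i j : Idx) :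
    (∑ k ∈ i.1.1, (inner ℂ (bf i k) (Torus.lerayCoeff k (crossForm 1 1 1 (bf j) k)) : ℂ)).re =
      ∑ a : Fin (odim i.1), ∑ a' : Fin (odim j.1),
        ((orbitBasis i.1).toBasis.toMatrix (e i.1)) a i.2 * ((orbitBasis j.1).toBasis.toMatrix (e j.1)) a' j.2 *
          amat ⟨i.1, a⟩ ⟨j.1, a'⟩ := by
  obtain ⟨O, b⟩ := i
  obtain ⟨O', b'⟩ := j
  -- abbreviations for the real coefficients
  set M : Matrix (Fin (odim O)) (Fin (odim O)) ℝ := (orbitBasis O).toBasis.toMatrix (e O) with hM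
  set M' : Matrix (Fin (odim O')) (Fin (odim O')) ℝ := (orbitBasis O').toBasis.toMatrix (e O') with hM'
  have hi := ebfam_expand e bf hbf O b
  have hj := ebfam_expand e bf hbf O' b'
  -- the complex pairing
  have key : ∑ k ∈ O.1, (inner ℂ (bf ⟨O, b⟩ k) (Torus.lerayCoeff k (crossForm 1 1 1 (bf ⟨O', b'⟩) k)) : ℂ) =
      ∑ a : Fin (odim O), ∑ a' : Fin (odim O'),
        (((M a b * M' a' b' * amat ⟨O, a⟩ ⟨O', a'⟩ : ℝ)) : ℂ) := by
    have e1 : ∀ k, (inner ℂ (bf ⟨O, b⟩ k) (Torus.lerayCoeff k (crossForm 1 1 1 (bf ⟨O', b'⟩) k)) : ℂ) =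
        ∑ a : Fin (odim O), ∑ a' : Fin (odim O'), ((M a b : ℝ) : ℂ) * ((M' a' b' : ℝ) : ℂ) *
          (inner ℂ (bfam ⟨O, a⟩ k) (Torus.lerayCoeff k (crossForm 1 1 1 (bfam ⟨O', a'⟩) k)) : ℂ) := by
      intro k
      rw [hj, lerayCrossForm_sum_smul (Finset.univ) (fun a' : Fin (odim O') => (⟨O', a'⟩ : Idx))
        (fun a' => ((M' a' b' : ℝ) : ℂ)) k, hi,
        sum_smul_bfam_apply (Finset.univ) (fun a : Fin (odim O) => (⟨O, a⟩ : Idx)) (fun a => ((M a b : ℝ) : ℂ)) k,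
        sum_inner]
      refine Finset.sum_congr rfl fun a _ => ?_
      rw [inner_sum]
      refine Finset.sum_congr rfl fun a' _ => ?_
      rw [inner_smul_left, inner_smul_right, Complex.conj_ofReal]
      ring
    rw [Finset.sum_congr rfl fun k _ => e1 k, Finset.sum_comm]
    refine Finset.sum_congr rfl fun a _ => ?_
    rw [Finset.sum_comm]
    refine Finset.sum_congr rfl fun a' _ => ?_
    rw [← Finset.mul_sum, ← amat_eq ⟨O, a⟩ ⟨O', a'⟩]
    push_cast
    ring
  rw [key]
  rw [show (∑ a : Fin (odim O), ∑ a' : Fin (odim O'), (((M a b * M' a' b' * amat ⟨O, a⟩ ⟨O', a'⟩ : ℝ)) : ℂ)) =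
    (((∑ a : Fin (odim O), ∑ a' : Fin (odim O'), M a b * M' a' b' * amat ⟨O, a⟩ ⟨O', a'⟩ : ℝ)) : ℂ) by push_cast; rfl,
    Complex.ofReal_re]

/-! ### §2 The coefficients as a kernel on `Idx × Idx`; orbit-saturated index sets -/

/-- Across different orbits the coefficients vanish (disjoint supports). -/
theorem coefQ_eq_zero_of_ne {i j : Idx} (h : i.1 ≠ j.1) :
    (∑ k ∈ i.1.1, (inner ℂ (bfam i k) (bf j k) : ℂ)).re = 0 := by
  rw [Finset.sum_eq_zero fun k hk => ?_, Complex.zero_re]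
  have hk' : k ∉ j.1.1 := fun h' => Finset.disjoint_left.mp (Orbit.disjoint_of_ne h) hk h'
  rw [ebfam_apply_of_not_mem e bf hbf j hk', inner_zero_right]

/-- On one orbit the coefficients are the entries of the change-of-basis matrix. -/
theorem coefQ_same (O : Orbit) (a b : Fin (odim O)) :
    (∑ k ∈ (⟨O, a⟩ : Idx).1.1, (inner ℂ (bfam ⟨O, a⟩ k) (bf ⟨O, b⟩ k) : ℂ)).re =
      ((orbitBasis O).toBasis.toMatrix (e O)) a b := by
  change (∑ k ∈ O.1, (inner ℂ (bfam ⟨O, a⟩ k) (bf ⟨O, b⟩ k) : ℂ)).re = _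
  rw [coef_eq e bf hbf O a b, Complex.ofReal_re]

end

/-- **Sums over an orbit-saturated index set of a function living on one orbit** are sums over the
basis index of that orbit. -/
theorem sum_saturated {T : Finset Idx} (O : Orbit) (hTO : ∀ a : Fin (odim O), (⟨O, a⟩ : Idx) ∈ T)
    (g : Idx → ℝ) (hg : ∀ i : Idx, i.1 ≠ O → g i = 0) :
    ∑ i ∈ T, g i = ∑ a : Fin (odim O), g ⟨O, a⟩ := by
  classical
  set SO : Finset Idx := (Finset.univ : Finset (Fin (odim O))).map
    ⟨fun a => (⟨O, a⟩ : Idx), fun a b h => eq_of_heq (Sigma.mk.inj_iff.mp h).2⟩ with hSO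
  have hsub : SO ⊆ T := by
    intro i hi
    obtain ⟨a, -, rfl⟩ := Finset.mem_map.mp hi
    exact hTO a
  rw [← Finset.sum_subset hsub fun i _ hi => hg i fun h => hi ?_, Finset.sum_map]
  · rfl
  · obtain ⟨O', a⟩ := i
    change O' = O at h
    subst h
    exact Finset.mem_map.mpr ⟨a, Finset.mem_univ _, rfl⟩

/-- `cubeIdx n` is orbit-saturated. -/
theorem cubeIdx_saturated (n : ℕ) {i : Idx} (hi : i ∈ cubeIdx n) (a : Fin (odim i.1)) :
    (⟨i.1, a⟩ : Idx) ∈ cubeIdx n := by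
  have h : osupNorm i.1 ≤ n := mem_cubeIdx.mp hi
  exact (mem_cubeIdx (i := ⟨i.1, a⟩)).mpr h

/-- Shells `cubeIdx m ∖ cubeIdx n` are orbit-saturated. -/
theorem shellIdx_saturated (m n : ℕ) {i : Idx} (hi : i ∈ cubeIdx m \ cubeIdx n) (a : Fin (odim i.1)) :
    (⟨i.1, a⟩ : Idx) ∈ cubeIdx m \ cubeIdx n := by
  have h := Finset.mem_sdiff.mp hi
  exact Finset.mem_sdiff.mpr ⟨cubeIdx_saturated m h.1 a,
    fun h' => h.2 ((mem_cubeIdx (i := i)).mpr ((mem_cubeIdx (i := ⟨i.1, a⟩)).mp h'))⟩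

section
include hbf

/-- **Column orthogonality of the coefficient kernel on a saturated index set**:
`Σ_{i ∈ T} Q i j · Q i j' = δ_{j j'}` for `j, j' ∈ T`. -/
theorem sum_coefQ_cols {T : Finset Idx} (hT : ∀ i ∈ T, ∀ a : Fin (odim i.1), (⟨i.1, a⟩ : Idx) ∈ T)
    {j j' : Idx} (hj : j ∈ T) (hj' : j' ∈ T) :
    ∑ i ∈ T, (∑ k ∈ i.1.1, (inner ℂ (bfam i k) (bf j k) : ℂ)).re *
        (∑ k ∈ i.1.1, (inner ℂ (bfam i k) (bf j' k) : ℂ)).re = if j = j' then 1 else 0 := by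
  obtain ⟨O, b⟩ := j
  obtain ⟨O', b'⟩ := j'
  by_cases hO : O = O'
  · subst hO
    rw [sum_saturated O (hT _ hj) _ fun i hi => by rw [coefQ_eq_zero_of_ne e bf hbf (j := ⟨O, b⟩) hi, zero_mul]]
    simp_rw [coefQ_same e bf hbf]
    rw [coefM_orth_cols]
    by_cases hb : b = b'
    · subst hb; simp
    · rw [if_neg hb]
      exact (if_neg (show (⟨O, b⟩ : Idx) ≠ ⟨O, b'⟩ from fun h => hb (eq_of_heq (Sigma.mk.inj_iff.mp h).2))).symm
  · refine Eq.trans ?_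
      (if_neg (show (⟨O, b⟩ : Idx) ≠ ⟨O', b'⟩ from fun h => hO (Sigma.mk.inj_iff.mp h).1)).symm
    refine Finset.sum_eq_zero fun i _ => ?_
    by_cases h1 : i.1 = O
    · have h2 : i.1 ≠ (⟨O', b'⟩ : Idx).1 := fun h => hO (h1.symm.trans h)
      rw [coefQ_eq_zero_of_ne e bf hbf (j := ⟨O', b'⟩) h2, mul_zero]
    · have h1' : i.1 ≠ (⟨O, b⟩ : Idx).1 := h1
      rw [coefQ_eq_zero_of_ne e bf hbf (j := ⟨O, b⟩) h1', zero_mul]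

/-- **Row orthogonality of the coefficient kernel on a saturated index set**:
`Σ_{j ∈ T} Q i j · Q i' j = δ_{i i'}` for `i, i' ∈ T`. -/
theorem sum_coefQ_rows {T : Finset Idx} (hT : ∀ i ∈ T, ∀ a : Fin (odim i.1), (⟨i.1, a⟩ : Idx) ∈ T)
    {i i' : Idx} (hi : i ∈ T) (hi' : i' ∈ T) :
    ∑ j ∈ T, (∑ k ∈ i.1.1, (inner ℂ (bfam i k) (bf j k) : ℂ)).re *
        (∑ k ∈ i'.1.1, (inner ℂ (bfam i' k) (bf j k) : ℂ)).re = if i = i' then 1 else 0 := by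
  obtain ⟨O, a⟩ := i
  obtain ⟨O', a'⟩ := i'
  by_cases hO : O = O'
  · subst hO
    rw [sum_saturated O (hT _ hi) _ fun j hj => by
      rw [coefQ_eq_zero_of_ne e bf hbf (i := ⟨O, a⟩) (Ne.symm hj), zero_mul]]
    simp_rw [coefQ_same e bf hbf]
    rw [coefM_orth_rows]
    by_cases ha : a = a'
    · subst ha; simp
    · rw [if_neg ha]
      exact (if_neg (show (⟨O, a⟩ : Idx) ≠ ⟨O, a'⟩ from fun h => ha (eq_of_heq (Sigma.mk.inj_iff.mp h).2))).symm
  · refine Eq.trans ?_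
      (if_neg (show (⟨O, a⟩ : Idx) ≠ ⟨O', a'⟩ from fun h => hO (Sigma.mk.inj_iff.mp h).1)).symm
    refine Finset.sum_eq_zero fun j _ => ?_
    by_cases h1 : j.1 = O
    · have h2 : (⟨O', a'⟩ : Idx).1 ≠ j.1 := fun h => hO (h1.symm.trans h.symm)
      rw [coefQ_eq_zero_of_ne e bf hbf h2, mul_zero]
    · have h1' : (⟨O, a⟩ : Idx).1 ≠ j.1 := Ne.symm h1
      rw [coefQ_eq_zero_of_ne e bf hbf h1', zero_mul]

/-- **The first-order matrix in the bases `e` as a double sum over saturated index sets**: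
for `j ∈ T₁`, `j' ∈ T₂`: `am j j' = Σ_{i ∈ T₁} Σ_{i' ∈ T₂} Q i j · amat i i' · Q i' j'`. -/
theorem eamat_eq_sum {T₁ T₂ : Finset Idx} (hT₁ : ∀ i ∈ T₁, ∀ a : Fin (odim i.1), (⟨i.1, a⟩ : Idx) ∈ T₁)
    (hT₂ : ∀ i ∈ T₂, ∀ a : Fin (odim i.1), (⟨i.1, a⟩ : Idx) ∈ T₂) {j j' : Idx} (hj : j ∈ T₁) (hj' : j' ∈ T₂) :
    (∑ k ∈ j.1.1, (inner ℂ (bf j k) (Torus.lerayCoeff k (crossForm 1 1 1 (bf j') k)) : ℂ)).re =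
      ∑ i ∈ T₁, ∑ i' ∈ T₂, (∑ k ∈ i.1.1, (inner ℂ (bfam i k) (bf j k) : ℂ)).re * amat i i' *
        (∑ k ∈ i'.1.1, (inner ℂ (bfam i' k) (bf j' k) : ℂ)).re := by
  rw [eamat_eq e bf hbf j j']
  rw [sum_saturated j.1 (hT₁ j hj) _ fun i hi => by
    rw [Finset.sum_eq_zero fun i' _ => by rw [coefQ_eq_zero_of_ne e bf hbf (i := i) (j := j) hi, zero_mul, zero_mul]]]
  refine Finset.sum_congr rfl fun a _ => ?_
  rw [sum_saturated j'.1 (hT₂ j' hj') _ fun i' hi' => by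
    rw [coefQ_eq_zero_of_ne e bf hbf (i := i') (j := j') hi', mul_zero]]
  refine Finset.sum_congr rfl fun a' _ => ?_
  obtain ⟨O, b⟩ := j
  obtain ⟨O', b'⟩ := j'
  simp only [coefQ_same e bf hbf]
  ring

end

end BasesPrep

end Summit.NavierStokesRegularity.FluidComputer.AbcClassII

end
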